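import Summits.HodgeConjecture.CorCM.GaloisSkewSection
import Summits.HodgeConjecture.CorCM.GaloisRightStabiliserDegenerate
import HarnessLib

/-!
# A NON-CENTRAL INVOLUTION IN THE GALOIS GROUP MAKES A LARGE GALOIS CM FIELD BAD: GOOD Galois CM fields of degree `≥ 64` have
# all their involutions central

COR-CM (cell `pub-hodgecm2`), binder seat b04 (gen 32), count-neutral own lane «Galois-CM-type classification».  KERNEL ONLY:
theorems; no definition, no named fact, no `sorry`.  `HC_CM` is neither used nor claimed.  Assembly of
`CorCM/GaloisSkewSection.exists_skew_of_noncentral_involution` (gen 32: a central involution `c`, a non-central involution `u`,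
`|G| ≥ 64` ⟹ a CM set with trivial LEFT and non-trivial RIGHT stabiliser) with gen 23's
`GaloisModels.exists_simple_degenerate_of_model_skew` (a skew CM set is read by a PRIMITIVE DEGENERATE CM type: its reflex field is
a proper subfield — Shimura §32.10 — while Shimura's §8.2 Prop. 26 makes the abelian variety simple).

* **`exists_simple_degenerate_of_noncentral_involution`** — model form: `e : Gal(K/ℚ) ≃* G₀`, `|G₀| ≥ 64`, `u ∈ G₀` an involution
  with `g u ≠ u g` for some `g` ⟹ `K` carries a SIMPLE DEGENERATE abelian variety of dimension `|G₀|/2` with CM by `K` (an exceptional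
  Hodge class on some power).
* **`exists_simple_degenerate_of_noncentral_involution_gal`** — the same on `Gal(K/ℚ)` itself, `[K:ℚ] ≥ 64`.
* **`commute_of_involution_of_forall_isNondegenerate`** — contrapositive: if every primitive CM type of `K` (`[K:ℚ] ≥ 64`) is
  nondegenerate — the Hodge ring of every power of every simple abelian variety with CM by `K` is generated by divisor classes — then
  EVERY INVOLUTION of `Gal(K/ℚ)` IS CENTRAL; equivalently every subfield `L ⊂ K` with `[K:L] = 2` is Galois over `ℚ`.
CONSEQUENCES for the seat's classification (A7-JUNCTION gen-32 addendum): together with the monotonicity theorem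
(`CorCM/GaloisDegenerateMonotone`) the GOOD pairs `(G, c)` of order `≥ 64` are confined to groups all of whose involutions are central
(`Ω₁ ≤ Z`); e.g. `H × C₄`, `H × Q₈`, `H × Γ` for any `H` with a non-central involution (all dihedral, symmetric, alternating real
factors), every 2-group of order `≥ 64` outside the class `Ω₁(G) ≤ Z(G)` — in particular every 2-group with cyclic centre other than
the cyclic and generalised quaternion groups — is BAD.  The threshold `64` is an artefact of the count (skew sections exist for
`S₃ × C₄` already); below it the seat's censuses apply.
«BAD» = a primitive degenerate CM type = an exceptional Hodge class on a power of a simple CM abelian variety (algebraicity open);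
«GOOD» = `B = D` on all powers of all simple CM abelian varieties with CM by the field.

## References

* [Shimura1998] G. Shimura, *Abelian Varieties with Complex Multiplication and Modular Functions*, §6.2 Thm. 3, §8.2 Prop. 26, §32.10.
* [Gordon1999HodgeAVSurvey] B. B. Gordon, *A survey of the Hodge conjecture for abelian varieties*, Thm. 6.4, §9.3.
* [Kubota1965] T. Kubota, *On the field extension by complex multiplication*, Trans. AMS 118 (1965), §2.
-/

noncomputable section

open CategoryTheory CategoryTheory.Limits NumberField
open scoped BigOperators

namespace Summit.HodgeConjecture.CorCM.GaloisModels

open Literature.NumberTheory.ComplexMultiplication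
open Literature.AlgebraicGeometry.Motives (AbelianVariety CMType)
open Literature.AlgebraicGeometry.HodgeTheory
open Literature.AlgebraicGeometry.ComplexMultiplication (IsCMTypeRealisation)
open Literature.AlgebraicGeometry.Pohlmann1968
open Literature.Barriers.HodgeConjecture (divisorClassesSpan)
open Summit.HodgeConjecture.CorCM.GaloisRank

variable {K : Type} [Field K] [NumberField K] [IsCMField K] [IsGalois ℚ K]

/-- **A NON-CENTRAL INVOLUTION MAKES THE FIELD BAD** (model form, `|G₀| ≥ 64`): `e : Gal(K/ℚ) ≃* G₀`, `u ∈ G₀` with `u² = 1` not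
central ⟹ `K` carries a SIMPLE DEGENERATE abelian variety of dimension `|G₀|/2` with CM by `K` and a rational `(p,p)` class outside
the divisor ring on some power. [cite: Shimura1998, §6.2 Thm. 3, §8.2 Prop. 26 and §32.10] [cite: Gordon1999HodgeAVSurvey, Thm. 6.4 and §9.3] -/
theorem exists_simple_degenerate_of_noncentral_involution {G₀ : Type*} [Group G₀] [Fintype G₀] [DecidableEq G₀]
    (e : (K ≃ₐ[ℚ] K) ≃* G₀) (u : G₀) (huu : u * u = 1) (hnc : ∃ g : G₀, g * u ≠ u * g) (hbig : 64 ≤ Fintype.card G₀) :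
    ∃ (Φ : CMType K) (φ₀ : K →+* ℂ) (A : AbelianVariety ℂ) (ι : 𝓞 K →+* End A)
      (θ : K →+* Module.End ℂ (complexBetti A.X 1)),
      IsPrimitive (ℂ ≃+* ℂ) Φ.1 φ₀ ∧ ¬ IsNondegenerate Φ ∧ IsCMTypeRealisation Φ A ι θ ∧ A.IsSimple ∧
      A.dim = Fintype.card G₀ / 2 ∧
      ∃ n p : ℕ, ∃ x : complexBetti (⨁ fun _ : Fin n => A).X (2 * p), IsRationalClass x ∧
        IsOfHodgeType (⨁ fun _ : Fin n => A).dim (⨁ fun _ : Fin n => A).X (2 * p) p p x ∧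
        x ∉ divisorClassesSpan (⨁ fun _ : Fin n => A).X (⨁ fun _ : Fin n => A).dim p := by
  classical
  set c := e ((IsCMField.complexConj K).restrictScalars ℚ) with hc_def
  have hcc : c * c = 1 := model_complexConj_mul_self e rfl
  have hc1 : c ≠ 1 := model_complexConj_ne_one e rfl
  have hcen : ∀ g : G₀, c * g = g * c := model_complexConj_comm e rfl
  have hu1 : u ≠ 1 := fun h => by obtain ⟨g, hg⟩ := hnc; exact hg (by rw [h, mul_one, one_mul])
  obtain ⟨T, hcm, hprim, hTu⟩ :=
    SkewSection.exists_skew_of_noncentral_involution c u hcc hc1 hcen huu hu1 hnc hbig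
  exact exists_simple_degenerate_of_model_skew e c rfl T hcm hprim hu1 hTu

/-- **… on `Gal(K/ℚ)` itself**: `[K:ℚ] ≥ 64` and an involution `σ ∈ Gal(K/ℚ)` not commuting with some `τ` ⟹ `K` carries a SIMPLE
DEGENERATE abelian variety of dimension `[K:ℚ]/2` with CM by `K`. [cite: Shimura1998, §6.2 Thm. 3, §8.2 Prop. 26 and §32.10]
[cite: Gordon1999HodgeAVSurvey, Thm. 6.4 and §9.3] -/
theorem exists_simple_degenerate_of_noncentral_involution_gal (σ : K ≃ₐ[ℚ] K) (hσ : σ * σ = 1)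
    (hnc : ∃ τ : K ≃ₐ[ℚ] K, τ * σ ≠ σ * τ) (hdeg : 64 ≤ Module.finrank ℚ K) :
    ∃ (Φ : CMType K) (φ₀ : K →+* ℂ) (A : AbelianVariety ℂ) (ι : 𝓞 K →+* End A)
      (θ : K →+* Module.End ℂ (complexBetti A.X 1)),
      IsPrimitive (ℂ ≃+* ℂ) Φ.1 φ₀ ∧ ¬ IsNondegenerate Φ ∧ IsCMTypeRealisation Φ A ι θ ∧ A.IsSimple ∧
      A.dim = Module.finrank ℚ K / 2 ∧
      ∃ n p : ℕ, ∃ x : complexBetti (⨁ fun _ : Fin n => A).X (2 * p), IsRationalClass x ∧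
        IsOfHodgeType (⨁ fun _ : Fin n => A).dim (⨁ fun _ : Fin n => A).X (2 * p) p p x ∧
        x ∉ divisorClassesSpan (⨁ fun _ : Fin n => A).X (⨁ fun _ : Fin n => A).dim p := by
  classical
  have hbig : 64 ≤ Fintype.card (K ≃ₐ[ℚ] K) := by rw [card_model_eq_finrank (MulEquiv.refl (K ≃ₐ[ℚ] K))]; exact hdeg
  obtain ⟨Φ, φ₀, A, ι, θ, H1, H2, H3, H4, H5, H6⟩ :=
    exists_simple_degenerate_of_noncentral_involution (MulEquiv.refl (K ≃ₐ[ℚ] K)) σ hσ hnc hbig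
  refine ⟨Φ, φ₀, A, ι, θ, H1, H2, H3, H4, ?_, H6⟩
  rw [H5, card_model_eq_finrank (MulEquiv.refl (K ≃ₐ[ℚ] K))]

/-- **GOOD Galois CM fields of degree `≥ 64` have all involutions central.**  If every primitive CM type of `K` is nondegenerate
(the Hodge ring of every power of every simple abelian variety with CM by `K` is generated by divisor classes), then every
`σ ∈ Gal(K/ℚ)` with `σ² = 1` commutes with every `τ` — equivalently, every subfield of index `2` in `K` is Galois over `ℚ`.
[cite: Shimura1998, §8.2 Prop. 26 and §32.10] -/
theorem commute_of_involution_of_forall_isNondegenerate (hdeg : 64 ≤ Module.finrank ℚ K)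
    (hgood : ∀ (Φ : CMType K) (φ : K →+* ℂ), IsPrimitive (ℂ ≃+* ℂ) Φ.1 φ → IsNondegenerate Φ)
    (σ : K ≃ₐ[ℚ] K) (hσ : σ * σ = 1) (τ : K ≃ₐ[ℚ] K) : τ * σ = σ * τ := by
  by_contra h
  obtain ⟨Φ, φ₀, A, ι, θ, H1, H2, -⟩ := exists_simple_degenerate_of_noncentral_involution_gal σ hσ ⟨τ, h⟩ hdeg
  exact H2 (hgood Φ φ₀ H1)

end Summit.HodgeConjecture.CorCM.GaloisModels

end
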